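import Literature.Computability.AlgebraicComplexity.FSV18OccurTopFanIn
import Literature.Computability.AlgebraicComplexity.FSV18OccurShiftReduction
import Literature.Computability.AlgebraicComplexity.FSV18OccurDegreeBound
import HarnessLib

/-!
# [ASSS16] §4 ¶1, the top-fan-in reduction as a class inclusion: unit differences of depth-`D`
# occur-`k` formulas are depth-`(D+1)` occur-`2k` formulas with top fan-in `≤ 2k`
# (val-lit p1 g3; N1 occur push, plan step F2a second half — the "model lemma")

Source: Agrawal–Saha–Saptharishi–Saxena, *Jacobian hits circuits*, arXiv:1111.0582 §4 ¶1 (held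
`paper:arxiv-1111.0582` p0009:L3–L24): "if `C(x_1, …, x_n)` is non-constant and nonzero, then there
is an `i` such that `C̃ := C(x_1, ⋯, x_i + 1, ⋯, x_n) − C(x_1, ⋯, x_n) ≠ 0` … If `C` has a `+` gate
on top then `C = Σ_{i=1}^m T_i` … Since `x_i` occurs in at most `k` of the `T_i`'s, `C̃` has top
fanin at most `2k`. If `C` has a `×⋏` gate on top then `C̃` has a `+` gate on top with fanin `2`
and depth`(C̃) = D + 1`. Therefore, `C̃` belongs to the class `𝒞̃` of depth-`(D+1)` occur-`2k`
formulas of size at most `(s² + s)`, and a `+` gate on top with fanin bounded by `2k`." Bib key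
`AgrawalEtAl2011`. The formula model is FSV Def. 45 (`OccurFormula`, `occurClass`,
`FSV18SuccinctGenerators.lean`); the reduced class is `occurClassTopFanIn`
(`FSV18OccurTopFanIn.lean`, p457041).

What is here (theorems only; no definitions, no named facts):
* §0 the FSV size of a leaf `Σ_{m ∈ supp p} (deg m + 1)` is subadditive and at most squares under
  the unit shift `X_{m₀} ↦ X_{m₀} + 1` (`leafSize_aeval_unitShift_le`; one monomial `c·X^d` shifts
  to `≤ d_{m₀} + 1` monomials of degree `≤ deg d`); the shift introduces no variables.
* §1 structural lemmas on the mutual inductive `OccurFormula`/`OccurArgs`/`OccurPowArgs` (mutual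
  structural recursion): no occurrence ⇒ not a variable of the value; an occurrence forces depth
  `≥ 2` and size `≥ 1`; closure under the unit shift with the same depth, no more occurrences and
  size `≤ size²` (`OccurFormula.exists_unitShift`).
* §2 the MODEL LEMMA `sub_mem_occurClassTopFanIn_of_mem_occurClass`: for `C ∈ occurClass D k s`
  and any `m₀`, `C(X + e_{m₀}) − C ∈ occurClassTopFanIn (D+1) (2k) ((s+2)²) (2k)` — print's
  `s² + s` becomes `(s+2)²` in FSV's size bookkeeping (a `+` gate costs `1`, the negation `(−1)·T`
  is a `×⋏` gate costing `T.size + 3`); the four cases of the print (`+` on top: keep the `≤ k`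
  children containing `X_{m₀}`, shifted and negated; `×⋏` on top: fan-in `2`, depth `+1`; a bare
  leaf; `C̃ = 0`).
* §3 the BRIDGE `ASSS16.isHittingSetGenerator_occurClass_of_topFanIn`: a generator
  `G ⊕ G^{SV'}_{n,K}` for the reduced class upgrades to the generator `G ⊕ G^{SV'}_{n,K+1}` for
  `occurClass D k s` in characteristic `0` or `> (s+1)^D` — composition of the landed
  `ASSS16.isHittingSetGenerator_succ_of_unitDifferences` (p456049) and
  `totalDegree_le_of_mem_occurClass` (p456577) with §2. With `FSV2018_thm48_topFanIn` (F1, the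
  [ASSS16] theorem as printed, to be discharged by F2–F4) at parameters `(D+1, 2k, (s+2)², 2k)` and
  `Φ := G^{SV'}_{n,K}` this is the tree's route to the occur conjunct of `FSV2018_thm9` (safe
  reading, lead-np RULING (33)) that bypasses `FSV2018_thm48` as typed (provenance B14/B21).

Honest framing: 2011/2016 bookkeeping ([ASSS16]) inside FSV's 2018 model; `VP ≠ VNP` is NOT proved
and nothing here bears on it.
-/

noncomputable section

namespace Literature.Computability.AlgebraicComplexity

open MvPolynomial Finset

variable {F : Type*} [Field F] {ι : Type*}

/-! ### §0 The FSV size of a leaf under sums and under a unit shift -/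

/-- FSV's size of a leaf, `Σ_{m ∈ supp p} (deg m + 1)` (local abbreviation-free phrasing: we state
every lemma with the sum written out). Subadditivity under `+`.
[cite: ForbesShpilkaVolk2018, Def. 45 (seq.) = ToC Def. 5.21 (size of a leaf)] -/
theorem leafSize_add_le [DecidableEq ι] (p q : MvPolynomial ι F) :
    ∑ m ∈ (p + q).support, (m.degree + 1) ≤
      ∑ m ∈ p.support, (m.degree + 1) + ∑ m ∈ q.support, (m.degree + 1) := by
  calc ∑ m ∈ (p + q).support, (m.degree + 1)
      ≤ ∑ m ∈ p.support ∪ q.support, (m.degree + 1) :=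
        Finset.sum_le_sum_of_subset_of_nonneg support_add (fun _ _ _ => Nat.zero_le _)
    _ ≤ ∑ m ∈ p.support, (m.degree + 1) + ∑ m ∈ q.support, (m.degree + 1) := by
        rw [← Finset.sum_union_inter]
        exact Nat.le_add_right _ _

/-- The size of a leaf is invariant under negation. [cite: ForbesShpilkaVolk2018, Def. 45 (seq.) = ToC Def. 5.21 (size of a leaf)] -/
theorem leafSize_neg (p : MvPolynomial ι F) :
    ∑ m ∈ (-p).support, (m.degree + 1) = ∑ m ∈ p.support, (m.degree + 1) := by
  rw [support_neg]

/-- Subadditivity of the leaf size under `−`. [cite: ForbesShpilkaVolk2018, Def. 45 (seq.) = ToC Def. 5.21 (size of a leaf)] -/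
theorem leafSize_sub_le [DecidableEq ι] (p q : MvPolynomial ι F) :
    ∑ m ∈ (p - q).support, (m.degree + 1) ≤
      ∑ m ∈ p.support, (m.degree + 1) + ∑ m ∈ q.support, (m.degree + 1) := by
  rw [sub_eq_add_neg]
  exact (leafSize_add_le p (-q)).trans (by rw [leafSize_neg])

/-- Subadditivity of the leaf size under finite sums. [cite: ForbesShpilkaVolk2018, Def. 45 (seq.) = ToC Def. 5.21 (size of a leaf)] -/
theorem leafSize_sum_le [DecidableEq ι] {α : Type*} (s : Finset α) (f : α → MvPolynomial ι F) :
    ∑ m ∈ (∑ a ∈ s, f a).support, (m.degree + 1) ≤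
      ∑ a ∈ s, ∑ m ∈ (f a).support, (m.degree + 1) :=
  Finset.le_sum_of_subadditive (fun p : MvPolynomial ι F => ∑ m ∈ p.support, (m.degree + 1))
    (by simp) (leafSize_add_le) s f

/-- The size of a constant leaf is at most `1`. [cite: ForbesShpilkaVolk2018, Def. 45 (seq.) = ToC Def. 5.21 (size of a leaf)] -/
theorem leafSize_C_le (c : F) :
    ∑ m ∈ (C c : MvPolynomial ι F).support, (m.degree + 1) ≤ 1 := by
  classical
  calc ∑ m ∈ (C c : MvPolynomial ι F).support, (m.degree + 1)
      ≤ ∑ m ∈ ({0} : Finset (ι →₀ ℕ)), (m.degree + 1) :=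
        Finset.sum_le_sum_of_subset_of_nonneg support_monomial_subset (fun _ _ _ => Nat.zero_le _)
    _ = 1 := by simp


/-! ### §0b A leaf under the unit shift `X_{m₀} ↦ X_{m₀} + 1` -/

section Shift

variable [DecidableEq ι]

/-- The unit shift of one monomial, `c·X^d ↦ c·(X_{m₀}+1)^{d_{m₀}}·X^{d − d_{m₀}e_{m₀}}`, has
at most `d_{m₀} + 1` monomials, each of degree `≤ deg d`; hence its FSV leaf size is at most
`(d_{m₀} + 1)·(deg d + 1)`. [cite: AgrawalEtAl2011, §4 (¶1, "size at most `s² + s`")]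
locator: paper:arxiv-1111.0582 p0009.txt:L10–L13 -/
theorem leafSize_aeval_unitShift_monomial_le (m₀ : ι) (d : ι →₀ ℕ) (c : F) :
    ∑ m ∈ (aeval (fun m : ι => if m = m₀ then X m + C 1 else (X m : MvPolynomial ι F))
        (monomial d c)).support, (m.degree + 1) ≤ (d m₀ + 1) * (d.degree + 1) := by
  set q := aeval (fun m : ι => if m = m₀ then X m + C 1 else (X m : MvPolynomial ι F))
    (monomial d c) with hq_def
  -- the shifted monomial, factored
  have hq : q = C c * ((X m₀ + C 1) ^ d m₀ * monomial (Finsupp.erase m₀ d) 1) := by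
    rw [hq_def, aeval_monomial, algebraMap_eq,
      ← Finsupp.mul_prod_erase' d m₀ _ (fun i => pow_zero _)]
    congr 2
    · simp
    · rw [Finsupp.prod, ← prod_X_pow_eq_monomial, Finsupp.support_erase]
      refine Finset.prod_congr rfl fun j hj => ?_
      rw [if_neg (Finset.ne_of_mem_erase hj)]
  -- (1) at most `d m₀ + 1` monomials
  have hcard : q.support.card ≤ d m₀ + 1 := by
    rw [hq, add_pow, Finset.sum_mul, Finset.mul_sum]
    refine (Finset.card_le_card support_sum).trans ((Finset.card_biUnion_le).trans ?_)
    calc ∑ a ∈ Finset.range (d m₀ + 1),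
          (C c * (X m₀ ^ a * C 1 ^ (d m₀ - a) * ((d m₀).choose a : MvPolynomial ι F) *
            monomial (Finsupp.erase m₀ d) 1)).support.card
        ≤ ∑ _a ∈ Finset.range (d m₀ + 1), 1 := by
          refine Finset.sum_le_sum fun a _ => ?_
          have hmono : C c * (X m₀ ^ a * C 1 ^ (d m₀ - a) * ((d m₀).choose a : MvPolynomial ι F) *
              monomial (Finsupp.erase m₀ d) 1) =
              monomial (Finsupp.single m₀ a + Finsupp.erase m₀ d) (c * ((d m₀).choose a : F)) := by
            rw [← C_eq_coe_nat, X_pow_eq_monomial, C_1, one_pow, mul_one, mul_comm (monomial _ _) (C _),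
              mul_assoc, monomial_mul, C_mul_monomial, C_mul_monomial, one_mul, mul_one]
          rw [hmono]
          exact (Finset.card_le_card support_monomial_subset).trans (by simp)
      _ = d m₀ + 1 := by simp
  -- (2) every monomial has degree `≤ deg d`
  have hdeg : q.totalDegree ≤ d.degree := by
    have h1 : (X m₀ + C 1 : MvPolynomial ι F).totalDegree ≤ 1 :=
      (totalDegree_add _ _).trans (max_le (totalDegree_X _).le (by rw [totalDegree_C]; exact Nat.zero_le _))
    have h2 : (monomial (Finsupp.erase m₀ d) (1 : F)).totalDegree ≤ (Finsupp.erase m₀ d).degree :=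
      totalDegree_monomial_le _ _
    have h3 : (Finsupp.erase m₀ d).degree + d m₀ = d.degree := by
      conv_rhs => rw [← Finsupp.erase_add_single m₀ d]
      rw [map_add, Finsupp.degree_single]
    rw [hq]
    refine (totalDegree_mul _ _).trans ?_
    rw [totalDegree_C, zero_add]
    refine (totalDegree_mul _ _).trans ?_
    calc ((X m₀ + C 1 : MvPolynomial ι F) ^ d m₀).totalDegree +
          (monomial (Finsupp.erase m₀ d) (1 : F)).totalDegree
        ≤ d m₀ * 1 + (Finsupp.erase m₀ d).degree :=
          Nat.add_le_add ((totalDegree_pow _ _).trans (Nat.mul_le_mul_left _ h1)) h2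
      _ = d.degree := by rw [mul_one, add_comm, h3]
  -- combine
  calc ∑ m ∈ q.support, (m.degree + 1)
      ≤ q.support.card • (d.degree + 1) := by
        refine Finset.sum_le_card_nsmul _ _ _ fun m hm => Nat.succ_le_succ ?_
        exact (le_totalDegree hm).trans hdeg
    _ ≤ (d m₀ + 1) * (d.degree + 1) := by
        rw [smul_eq_mul]; exact Nat.mul_le_mul_right _ hcard

/-- **A leaf under the unit shift has FSV size at most `size²`** ([ASSS16] §4 ¶1: the shifted
formula has "size at most `s² + s`"; FSV's size of a leaf is `Σ_m (deg m + 1)`).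
[cite: AgrawalEtAl2011, §4 (¶1)] locator: paper:arxiv-1111.0582 p0009.txt:L10–L13 -/
theorem leafSize_aeval_unitShift_le (m₀ : ι) (p : MvPolynomial ι F) :
    ∑ m ∈ (aeval (fun m : ι => if m = m₀ then X m + C 1 else (X m : MvPolynomial ι F)) p).support,
        (m.degree + 1) ≤ (∑ m ∈ p.support, (m.degree + 1)) ^ 2 := by
  conv_lhs => rw [p.as_sum, map_sum]
  refine (leafSize_sum_le _ _).trans ?_
  calc ∑ d ∈ p.support, ∑ m ∈ (aeval (fun m : ι => if m = m₀ then X m + C 1 else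
          (X m : MvPolynomial ι F)) (monomial d (coeff d p))).support, (m.degree + 1)
      ≤ ∑ d ∈ p.support, (d.degree + 1) * (d.degree + 1) := by
        refine Finset.sum_le_sum fun d _ => (leafSize_aeval_unitShift_monomial_le m₀ d _).trans ?_
        exact Nat.mul_le_mul_right _ (Nat.succ_le_succ (Finsupp.le_degree m₀ d))
    _ ≤ ∑ d ∈ p.support, (d.degree + 1) * ∑ m ∈ p.support, (m.degree + 1) := by
        refine Finset.sum_le_sum fun d hd => Nat.mul_le_mul_left _ ?_
        exact Finset.single_le_sum (f := fun m : ι →₀ ℕ => m.degree + 1) (fun _ _ => Nat.zero_le _) hd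
    _ = (∑ m ∈ p.support, (m.degree + 1)) ^ 2 := by rw [← Finset.sum_mul, sq]

/-- The unit shift does not introduce variables: `vars p(X + e_{m₀}) ⊆ vars p`. [cite: AgrawalEtAl2011, §4 (¶1)] -/
theorem vars_aeval_unitShift_subset (m₀ : ι) (p : MvPolynomial ι F) :
    (aeval (fun m : ι => if m = m₀ then X m + C 1 else (X m : MvPolynomial ι F)) p).vars ⊆ p.vars := by
  rw [aeval_eq_bind₁]
  refine (vars_bind₁ _ _).trans (Finset.biUnion_subset.2 fun i hi => ?_)
  by_cases h : i = m₀
  · subst h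
    rw [if_pos rfl]
    refine (vars_add_subset _ _).trans (Finset.union_subset ?_ ?_)
    · rw [vars_X]; exact Finset.singleton_subset_iff.2 hi
    · rw [vars_C]; exact Finset.empty_subset _
  · rw [if_neg h, vars_X]; exact Finset.singleton_subset_iff.2 hi

/-- If `X_{m₀}` does not occur in `p` the unit shift fixes `p`. [cite: AgrawalEtAl2011, §4 (¶1)] -/
theorem aeval_unitShift_eq_self_of_notMem_vars {m₀ : ι} {p : MvPolynomial ι F} (h : m₀ ∉ p.vars) :
    aeval (fun m : ι => if m = m₀ then X m + C 1 else (X m : MvPolynomial ι F)) p = p := by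
  conv_rhs => rw [← aeval_X_left_apply (R := F) p]
  refine hom_congr_vars (f₁ := (aeval _ : MvPolynomial ι F →ₐ[F] MvPolynomial ι F).toRingHom)
    (f₂ := (aeval X : MvPolynomial ι F →ₐ[F] MvPolynomial ι F).toRingHom) ?_ (fun i hi _ => ?_) rfl
  · ext c; simp
  · have hne : i ≠ m₀ := fun h' => h (h' ▸ hi)
    simp [hne]

end Shift


/-! ### §1 Structural lemmas on the occur-formula model (FSV Def. 45) -/

section Structural

mutual
/-- A variable with no occurrence in a formula does not occur in the polynomial it computes.
[cite: ForbesShpilkaVolk2018, Def. 45 (seq.) = ToC Def. 5.21] -/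
theorem OccurFormula.notMem_vars_eval_of_occur_eq_zero (i : ι) : ∀ φ : OccurFormula F ι,
    φ.occur i = 0 → i ∉ φ.eval.vars
  | .leaf p => by
    intro h
    simp only [OccurFormula.occur] at h
    simp only [OccurFormula.eval]
    by_cases hp : p.degreeOf i = 0
    · rw [mem_vars_iff_degreeOf_ne_zero]; exact fun h' => h' hp
    · rw [if_neg hp] at h; exact absurd h one_ne_zero
  | .add as => by
    intro h
    simp only [OccurFormula.occur] at h
    simp only [OccurFormula.eval]
    exact OccurArgs.notMem_vars_evalSum_of_occur_eq_zero i as h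
  | .powProd ps => by
    intro h
    simp only [OccurFormula.occur] at h
    simp only [OccurFormula.eval]
    exact OccurPowArgs.notMem_vars_evalProd_of_occur_eq_zero i ps h

/-- `+`-argument lists: no occurrence ⇒ not a variable of the sum. [cite: ForbesShpilkaVolk2018, Def. 45 (seq.) = ToC Def. 5.21] -/
theorem OccurArgs.notMem_vars_evalSum_of_occur_eq_zero (i : ι) : ∀ as : OccurArgs F ι,
    as.occur i = 0 → i ∉ as.evalSum.vars
  | .nil => by
    intro _
    simp only [OccurArgs.evalSum, vars_0]
    exact Finset.notMem_empty _
  | .cons φ rest => by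
    classical
    intro h
    simp only [OccurArgs.occur, Nat.add_eq_zero_iff] at h
    simp only [OccurArgs.evalSum]
    intro hmem
    rcases Finset.mem_union.1 (vars_add_subset _ _ hmem) with h1 | h1
    · exact OccurFormula.notMem_vars_eval_of_occur_eq_zero i φ h.1 h1
    · exact OccurArgs.notMem_vars_evalSum_of_occur_eq_zero i rest h.2 h1

/-- `×∧`-argument lists: no occurrence ⇒ not a variable of the power product. [cite: ForbesShpilkaVolk2018, Def. 45 (seq.) = ToC Def. 5.21] -/
theorem OccurPowArgs.notMem_vars_evalProd_of_occur_eq_zero (i : ι) : ∀ ps : OccurPowArgs F ι,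
    ps.occur i = 0 → i ∉ ps.evalProd.vars
  | .nil => by
    intro _
    simp only [OccurPowArgs.evalProd, vars_one]
    exact Finset.notMem_empty _
  | .cons φ e rest => by
    classical
    intro h
    simp only [OccurPowArgs.occur, Nat.add_eq_zero_iff] at h
    simp only [OccurPowArgs.evalProd]
    intro hmem
    rcases Finset.mem_union.1 (vars_mul _ _ hmem) with h1 | h1
    · exact OccurFormula.notMem_vars_eval_of_occur_eq_zero i φ h.1 (vars_pow _ _ h1)
    · exact OccurPowArgs.notMem_vars_evalProd_of_occur_eq_zero i rest h.2 h1
end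

mutual
/-- A formula in which some variable occurs contains a leaf, hence has depth `≥ 2`.
[cite: ForbesShpilkaVolk2018, Def. 45 (seq.) = ToC Def. 5.21] -/
theorem OccurFormula.two_le_depth_of_occur_ne_zero (i : ι) : ∀ φ : OccurFormula F ι,
    φ.occur i ≠ 0 → 2 ≤ φ.depth
  | .leaf p => by
    intro _
    simp only [OccurFormula.depth, le_refl]
  | .add as => by
    intro h
    simp only [OccurFormula.occur] at h
    simp only [OccurFormula.depth]
    exact (OccurArgs.two_le_depth_of_occur_ne_zero i as h).trans (Nat.le_add_left _ _)
  | .powProd ps => by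
    intro h
    simp only [OccurFormula.occur] at h
    simp only [OccurFormula.depth]
    exact (OccurPowArgs.two_le_depth_of_occur_ne_zero i ps h).trans (Nat.le_add_left _ _)

/-- `+`-argument lists: an occurrence forces depth `≥ 2`. [cite: ForbesShpilkaVolk2018, Def. 45 (seq.) = ToC Def. 5.21] -/
theorem OccurArgs.two_le_depth_of_occur_ne_zero (i : ι) : ∀ as : OccurArgs F ι,
    as.occur i ≠ 0 → 2 ≤ as.depth
  | .nil => by
    intro h
    simp only [OccurArgs.occur] at h
    exact absurd rfl h
  | .cons φ rest => by
    intro h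
    simp only [OccurArgs.occur] at h
    simp only [OccurArgs.depth]
    by_cases hφ : φ.occur i = 0
    · rw [hφ, zero_add] at h
      exact (OccurArgs.two_le_depth_of_occur_ne_zero i rest h).trans (le_max_right _ _)
    · exact (OccurFormula.two_le_depth_of_occur_ne_zero i φ hφ).trans (le_max_left _ _)

/-- `×∧`-argument lists: an occurrence forces depth `≥ 2`. [cite: ForbesShpilkaVolk2018, Def. 45 (seq.) = ToC Def. 5.21] -/
theorem OccurPowArgs.two_le_depth_of_occur_ne_zero (i : ι) : ∀ ps : OccurPowArgs F ι,
    ps.occur i ≠ 0 → 2 ≤ ps.depth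
  | .nil => by
    intro h
    simp only [OccurPowArgs.occur] at h
    exact absurd rfl h
  | .cons φ e rest => by
    intro h
    simp only [OccurPowArgs.occur] at h
    simp only [OccurPowArgs.depth]
    by_cases hφ : φ.occur i = 0
    · rw [hφ, zero_add] at h
      exact (OccurPowArgs.two_le_depth_of_occur_ne_zero i rest h).trans (le_max_right _ _)
    · exact (OccurFormula.two_le_depth_of_occur_ne_zero i φ hφ).trans (le_max_left _ _)
end

mutual
/-- A formula in which some variable occurs has a nonzero leaf, hence size `≥ 1`.
[cite: ForbesShpilkaVolk2018, Def. 45 (seq.) = ToC Def. 5.21] -/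
theorem OccurFormula.one_le_size_of_occur_ne_zero (i : ι) : ∀ φ : OccurFormula F ι,
    φ.occur i ≠ 0 → 1 ≤ φ.size
  | .leaf p => by
    intro h
    simp only [OccurFormula.occur] at h
    simp only [OccurFormula.size]
    have hp : p.degreeOf i ≠ 0 := fun h' => h (by rw [if_pos h'])
    obtain ⟨d, hd, -⟩ := (mem_vars_iff_mem_support i).1 (mem_vars_iff_degreeOf_ne_zero.2 hp)
    exact le_trans (Nat.le_add_left 1 _)
      (Finset.single_le_sum (f := fun m : ι →₀ ℕ => m.degree + 1) (fun _ _ => Nat.zero_le _) hd)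
  | .add as => by
    intro _
    simp only [OccurFormula.size]
    exact Nat.le_add_right _ _
  | .powProd ps => by
    intro h
    simp only [OccurFormula.occur] at h
    simp only [OccurFormula.size]
    exact OccurPowArgs.one_le_size_of_occur_ne_zero i ps h

/-- `+`-argument lists: an occurrence forces size `≥ 1`. [cite: ForbesShpilkaVolk2018, Def. 45 (seq.) = ToC Def. 5.21] -/
theorem OccurArgs.one_le_size_of_occur_ne_zero (i : ι) : ∀ as : OccurArgs F ι,
    as.occur i ≠ 0 → 1 ≤ as.size
  | .nil => by
    intro h
    simp only [OccurArgs.occur] at h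
    exact absurd rfl h
  | .cons φ rest => by
    intro h
    simp only [OccurArgs.occur] at h
    simp only [OccurArgs.size]
    by_cases hφ : φ.occur i = 0
    · rw [hφ, zero_add] at h
      exact (OccurArgs.one_le_size_of_occur_ne_zero i rest h).trans (Nat.le_add_left _ _)
    · exact (OccurFormula.one_le_size_of_occur_ne_zero i φ hφ).trans (Nat.le_add_right _ _)

/-- `×∧`-argument lists: an occurrence forces size `≥ 1`. [cite: ForbesShpilkaVolk2018, Def. 45 (seq.) = ToC Def. 5.21] -/
theorem OccurPowArgs.one_le_size_of_occur_ne_zero (i : ι) : ∀ ps : OccurPowArgs F ι,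
    ps.occur i ≠ 0 → 1 ≤ ps.size
  | .nil => by
    intro h
    simp only [OccurPowArgs.occur] at h
    exact absurd rfl h
  | .cons φ e rest => by
    intro h
    simp only [OccurPowArgs.occur] at h
    simp only [OccurPowArgs.size]
    by_cases hφ : φ.occur i = 0
    · rw [hφ, zero_add] at h
      exact (OccurPowArgs.one_le_size_of_occur_ne_zero i rest h).trans (Nat.le_add_left _ _)
    · exact (OccurFormula.one_le_size_of_occur_ne_zero i φ hφ).trans
        ((Nat.le_add_left _ _).trans (Nat.le_add_right _ _))
end

section UnitShift

variable [DecidableEq ι]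

mutual
/-- **Occur formulas are closed under the unit shift `X_{m₀} ↦ X_{m₀} + 1`** with the same
depth, no more occurrences, and size at most `size²` ([ASSS16] §4 ¶1: "`C̃` belongs to the class
of depth-`(D+1)` occur-`2k` formulas of size at most `s² + s`" — the shifted copy).
[cite: AgrawalEtAl2011, §4 (¶1)] locator: paper:arxiv-1111.0582 p0009.txt:L3–L13 -/
theorem OccurFormula.exists_unitShift (m₀ : ι) : ∀ φ : OccurFormula F ι, ∃ φ' : OccurFormula F ι,
    φ'.eval = aeval (fun m : ι => if m = m₀ then X m + C 1 else (X m : MvPolynomial ι F)) φ.eval ∧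
      φ'.depth = φ.depth ∧ (∀ i, φ'.occur i ≤ φ.occur i) ∧ φ'.size ≤ φ.size ^ 2
  | .leaf p => by
    refine ⟨.leaf (aeval (fun m : ι => if m = m₀ then X m + C 1 else (X m : MvPolynomial ι F)) p),
      ?_, ?_, fun i => ?_, ?_⟩
    · simp only [OccurFormula.eval]
    · simp only [OccurFormula.depth]
    · simp only [OccurFormula.occur]
      by_cases hp : p.degreeOf i = 0
      · have h1 : i ∉ p.vars := fun h' => (mem_vars_iff_degreeOf_ne_zero.1 h') hp
        have h2 : (aeval (fun m : ι => if m = m₀ then X m + C 1 else (X m : MvPolynomial ι F))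
            p).degreeOf i = 0 := by
          by_contra h'
          exact h1 (vars_aeval_unitShift_subset m₀ p (mem_vars_iff_degreeOf_ne_zero.2 h'))
        rw [if_pos h2]
        exact Nat.zero_le _
      · rw [if_neg hp]
        split_ifs <;> omega
    · simp only [OccurFormula.size]
      exact leafSize_aeval_unitShift_le m₀ p
  | .add as => by
    obtain ⟨as', h1, h2, h3, h4⟩ := OccurArgs.exists_unitShift m₀ as
    refine ⟨.add as', ?_, ?_, fun i => ?_, ?_⟩
    · simp only [OccurFormula.eval]; exact h1
    · simp only [OccurFormula.depth, h2]
    · simp only [OccurFormula.occur]; exact h3 i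
    · simp only [OccurFormula.size]
      have s1 := add_sq 1 as.size
      omega
  | .powProd ps => by
    obtain ⟨ps', h1, h2, h3, h4⟩ := OccurPowArgs.exists_unitShift m₀ ps
    refine ⟨.powProd ps', ?_, ?_, fun i => ?_, ?_⟩
    · simp only [OccurFormula.eval]; exact h1
    · simp only [OccurFormula.depth, h2]
    · simp only [OccurFormula.occur]; exact h3 i
    · simp only [OccurFormula.size]; exact h4

/-- `+`-argument lists under the unit shift. [cite: AgrawalEtAl2011, §4 (¶1)] -/
theorem OccurArgs.exists_unitShift (m₀ : ι) : ∀ as : OccurArgs F ι, ∃ as' : OccurArgs F ι,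
    as'.evalSum = aeval (fun m : ι => if m = m₀ then X m + C 1 else (X m : MvPolynomial ι F))
      as.evalSum ∧ as'.depth = as.depth ∧ (∀ i, as'.occur i ≤ as.occur i) ∧
      as'.size ≤ as.size ^ 2
  | .nil => ⟨.nil, by simp only [OccurArgs.evalSum, map_zero], rfl, fun _ => le_rfl,
      by simp only [OccurArgs.size]; exact Nat.zero_le _⟩
  | .cons φ rest => by
    obtain ⟨φ', h1, h2, h3, h4⟩ := OccurFormula.exists_unitShift m₀ φ
    obtain ⟨rest', g1, g2, g3, g4⟩ := OccurArgs.exists_unitShift m₀ rest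
    refine ⟨.cons φ' rest', ?_, ?_, fun i => ?_, ?_⟩
    · simp only [OccurArgs.evalSum, map_add, h1, g1]
    · simp only [OccurArgs.depth, h2, g2]
    · simp only [OccurArgs.occur]; exact Nat.add_le_add (h3 i) (g3 i)
    · simp only [OccurArgs.size]
      have s1 := add_sq φ.size rest.size
      omega

/-- `×∧`-argument lists under the unit shift. [cite: AgrawalEtAl2011, §4 (¶1)] -/
theorem OccurPowArgs.exists_unitShift (m₀ : ι) : ∀ ps : OccurPowArgs F ι, ∃ ps' : OccurPowArgs F ι,
    ps'.evalProd = aeval (fun m : ι => if m = m₀ then X m + C 1 else (X m : MvPolynomial ι F))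
      ps.evalProd ∧ ps'.depth = ps.depth ∧ (∀ i, ps'.occur i ≤ ps.occur i) ∧
      ps'.size ≤ ps.size ^ 2
  | .nil => ⟨.nil, by simp only [OccurPowArgs.evalProd, map_one], rfl, fun _ => le_rfl,
      by simp only [OccurPowArgs.size]; exact Nat.zero_le _⟩
  | .cons φ e rest => by
    obtain ⟨φ', h1, h2, h3, h4⟩ := OccurFormula.exists_unitShift m₀ φ
    obtain ⟨rest', g1, g2, g3, g4⟩ := OccurPowArgs.exists_unitShift m₀ rest
    refine ⟨.cons φ' e rest', ?_, ?_, fun i => ?_, ?_⟩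
    · simp only [OccurPowArgs.evalProd, map_mul, map_pow, h1, g1]
    · simp only [OccurPowArgs.depth, h2, g2]
    · simp only [OccurPowArgs.occur]; exact Nat.add_le_add (h3 i) (g3 i)
    · simp only [OccurPowArgs.size]
      have s1 := add_sq (e + φ.size) rest.size
      have s2 := add_sq e φ.size
      have s3 := Nat.le_mul_self e
      rw [← sq] at s3
      omega
end

end UnitShift

end Structural


/-! ### §2 [ASSS16] §4 ¶1: the unit difference `C(X + e_{m₀}) − C(X)` of a depth-`D` occur-`k`
size-`s` formula is a depth-`(D+1)` occur-`2k` formula with a `+` gate of fan-in `≤ 2k` on top -/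

section UnitDifference

variable [DecidableEq ι]

/-- The `+`-gate case, child by child: "If `C` has a `+` gate on top then `C = Σ_i T_i` … Since
`x_i` occurs in at most `k` of the `T_i`'s, `C̃` has top fanin at most `2k`" — for an argument list
`as`, the list `as'` of the shifted copies `T(X + e_{m₀})` and the negations `(−1)·T` of the
children `T` in which `X_{m₀}` occurs computes `Σ_T (T(X+e_{m₀}) − T)`, has at most
`2·#{T : X_{m₀} occurs in T}` members, depth `≤ depth + 1` (the negation is a `×∧` gate), at most
twice the occurrences, and size `≤ size² + 4·size`.
[cite: AgrawalEtAl2011, §4 (¶1)] locator: paper:arxiv-1111.0582 p0009.txt:L7–L13 -/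
theorem OccurArgs.exists_unitDifference (m₀ : ι) : ∀ as : OccurArgs F ι, ∃ as' : OccurArgs F ι,
    as'.evalSum = aeval (fun m : ι => if m = m₀ then X m + C 1 else (X m : MvPolynomial ι F))
      as.evalSum - as.evalSum ∧ as'.depth ≤ as.depth + 1 ∧ (∀ i, as'.occur i ≤ 2 * as.occur i) ∧
      as'.size ≤ as.size ^ 2 + 4 * as.size ∧ as'.length ≤ 2 * as.occur m₀
  | .nil => ⟨.nil, by simp only [OccurArgs.evalSum, map_zero, sub_zero],
      by simp only [OccurArgs.depth]; exact Nat.zero_le _, fun _ => by simp only [OccurArgs.occur, mul_zero, le_refl],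
      by simp only [OccurArgs.size]; exact Nat.zero_le _,
      by simp only [OccurArgs.length, OccurArgs.occur, mul_zero, le_refl]⟩
  | .cons T rest => by
    obtain ⟨rest', g1, g2, g3, g4, g5⟩ := OccurArgs.exists_unitDifference m₀ rest
    by_cases hT : T.occur m₀ = 0
    · -- `X_{m₀}` does not occur in `T`: the shift fixes `T`, drop it
      have hfix : aeval (fun m : ι => if m = m₀ then X m + C 1 else (X m : MvPolynomial ι F))
          T.eval = T.eval :=
        aeval_unitShift_eq_self_of_notMem_vars
          (OccurFormula.notMem_vars_eval_of_occur_eq_zero m₀ T hT)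
      refine ⟨rest', ?_, ?_, fun i => ?_, ?_, ?_⟩
      · simp only [OccurArgs.evalSum, map_add, hfix, g1]; ring
      · simp only [OccurArgs.depth]; omega
      · simp only [OccurArgs.occur]; exact (g3 i).trans (by omega)
      · simp only [OccurArgs.size]
        have s1 := add_sq T.size rest.size
        omega
      · simp only [OccurArgs.occur, hT, zero_add]; exact g5
    · -- `X_{m₀}` occurs in `T`: keep `T(X + e_{m₀})` and `(−1)·T`
      obtain ⟨T', h1, h2, h3, h4⟩ := OccurFormula.exists_unitShift m₀ T
      have hd : 2 ≤ T.depth := OccurFormula.two_le_depth_of_occur_ne_zero m₀ T hT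
      have hs : 1 ≤ T.size := OccurFormula.one_le_size_of_occur_ne_zero m₀ T hT
      have hC := leafSize_C_le (ι := ι) (-1 : F)
      refine ⟨.cons T' (.cons (.powProd (.cons (.leaf (C (-1))) 1 (.cons T 1 .nil))) rest'),
        ?_, ?_, fun i => ?_, ?_, ?_⟩
      · simp only [OccurArgs.evalSum, OccurFormula.eval, OccurPowArgs.evalProd, h1, g1, map_add,
          map_neg, C_1, pow_one, mul_one]
        ring
      · simp only [OccurArgs.depth, OccurFormula.depth, OccurPowArgs.depth, h2]
        omega
      · simp only [OccurArgs.occur, OccurFormula.occur, OccurPowArgs.occur, degreeOf_C]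
        have := h3 i
        have := g3 i
        simp only [if_true]
        omega
      · simp only [OccurArgs.size, OccurFormula.size, OccurPowArgs.size]
        have s1 := add_sq T.size rest.size
        omega
      · simp only [OccurArgs.length, OccurArgs.occur]
        omega

/-- **[ASSS16] §4 ¶1, the top-fan-in reduction as a CLASS INCLUSION (FSV model):** for `C` computed
by a depth-`D` occur-`k` size-`s` formula and any variable `X_{m₀}`, the unit difference
`C̃ = C(X + e_{m₀}) − C(X)` "belongs to the class `𝒞̃` of depth-`(D+1)` occur-`2k` formulas … and a
`+` gate on top with fanin bounded by `2k`"; in FSV's size bookkeeping (leaf = `Σ_m (deg m + 1)`,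
`+` gate = `1`, the negation `(−1)·T` a `×∧` gate of size `T.size + 3`) the size is `≤ (s + 2)²`
(print: "`s² + s`"). Cases as in print: `+` on top (`OccurArgs.exists_unitDifference`), `×∧` on top
("`C̃` has a `+` gate on top with fanin `2` and depth `D + 1`"), a bare leaf, and `C̃ = 0`.
[cite: AgrawalEtAl2011, §4 (¶1)] locator: paper:arxiv-1111.0582 p0009.txt:L3–L24 -/
theorem sub_mem_occurClassTopFanIn_of_mem_occurClass {D k s : ℕ} {C₀ : MvPolynomial ι F}
    (hC : C₀ ∈ occurClass F ι D k s) (m₀ : ι) :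
    aeval (fun m : ι => if m = m₀ then X m + C 1 else (X m : MvPolynomial ι F)) C₀ - C₀ ∈
      occurClassTopFanIn F ι (D + 1) (2 * k) ((s + 2) ^ 2) (2 * k) := by
  have hsq : (s + 2) ^ 2 = s ^ 2 + 4 * s + 4 := by ring
  obtain ⟨φ, hφ, hD, hk, hs⟩ := hC
  by_cases h0 : aeval (fun m : ι => if m = m₀ then X m + C 1 else (X m : MvPolynomial ι F)) C₀ -
      C₀ = 0
  · rw [h0]
    refine ⟨.nil, ?_, ?_, fun i => ?_, ?_, ?_⟩
    · simp only [OccurFormula.eval, OccurArgs.evalSum]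
    · simp only [OccurFormula.depth, OccurArgs.depth]; omega
    · simp only [OccurFormula.occur, OccurArgs.occur]; exact Nat.zero_le _
    · simp only [OccurFormula.size, OccurArgs.size]; omega
    · simp only [OccurArgs.length]; exact Nat.zero_le _
  · have hocc : φ.occur m₀ ≠ 0 := by
      intro h'
      apply h0
      rw [← hφ, aeval_unitShift_eq_self_of_notMem_vars
        (OccurFormula.notMem_vars_eval_of_occur_eq_zero m₀ φ h'), sub_self]
    have hk1 : 1 ≤ k := by have := hk m₀; omega
    subst hφ
    cases φ with
    | leaf p =>
      refine ⟨.cons (.leaf (aeval (fun m : ι => if m = m₀ then X m + C 1 else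
          (X m : MvPolynomial ι F)) p - p)) .nil, ?_, ?_, fun i => ?_, ?_, ?_⟩
      · simp only [OccurFormula.eval, OccurArgs.evalSum, add_zero]
      · simp only [OccurFormula.depth, OccurArgs.depth] at hD ⊢; omega
      · have hki := hk i
        simp only [OccurFormula.occur, OccurArgs.occur, add_zero] at hki ⊢
        by_cases hp : p.degreeOf i = 0
        · have h1 : i ∉ p.vars := fun h' => (mem_vars_iff_degreeOf_ne_zero.1 h') hp
          have h2 : (aeval (fun m : ι => if m = m₀ then X m + C 1 else (X m : MvPolynomial ι F)) p -
              p).degreeOf i = 0 := by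
            by_contra h'
            rcases Finset.mem_union.1 (vars_sub_subset _ (mem_vars_iff_degreeOf_ne_zero.2 h'))
              with h3 | h3
            · exact h1 (vars_aeval_unitShift_subset m₀ p h3)
            · exact h1 h3
          rw [if_pos h2]; exact Nat.zero_le _
        · split_ifs <;> omega
      · simp only [OccurFormula.size, OccurArgs.size, add_zero] at hs ⊢
        have h1 := leafSize_sub_le (aeval (fun m : ι => if m = m₀ then X m + C 1 else
          (X m : MvPolynomial ι F)) p) p
        have h2 := leafSize_aeval_unitShift_le m₀ p
        have h3 := Nat.pow_le_pow_left hs 2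
        omega
      · simp only [OccurArgs.length]; omega
    | add as =>
      obtain ⟨as', g1, g2, g3, g4, g5⟩ := OccurArgs.exists_unitDifference m₀ as
      refine ⟨as', ?_, ?_, fun i => ?_, ?_, ?_⟩
      · simp only [OccurFormula.eval]; exact g1
      · simp only [OccurFormula.depth] at hD ⊢; omega
      · have hki := hk i
        simp only [OccurFormula.occur] at hki ⊢
        exact (g3 i).trans (by omega)
      · simp only [OccurFormula.size] at hs ⊢
        have h3 := Nat.pow_le_pow_left (show as.size ≤ s by omega) 2
        omega
      · have hkm := hk m₀
        simp only [OccurFormula.occur] at hkm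
        exact g5.trans (by omega)
    | powProd ps =>
      obtain ⟨φ', h1, h2, h3, h4⟩ := OccurFormula.exists_unitShift m₀ (.powProd ps)
      have hocc' : ps.occur m₀ ≠ 0 := by simpa only [OccurFormula.occur] using hocc
      have hd2 : 2 ≤ ps.depth := OccurPowArgs.two_le_depth_of_occur_ne_zero m₀ ps hocc'
      have hC := leafSize_C_le (ι := ι) (-1 : F)
      refine ⟨.cons φ' (.cons (.powProd (.cons (.leaf (C (-1))) 1 ps)) .nil), ?_, ?_, fun i => ?_,
        ?_, ?_⟩
      · simp only [OccurFormula.eval, OccurArgs.evalSum, OccurPowArgs.evalProd, h1, map_neg, C_1,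
          pow_one, add_zero]
        ring
      · simp only [OccurFormula.depth, OccurArgs.depth, OccurPowArgs.depth] at hD h2 ⊢
        omega
      · have hki := hk i
        have h3i := h3 i
        simp only [OccurFormula.occur, OccurArgs.occur, OccurPowArgs.occur, degreeOf_C,
          if_true] at hki h3i ⊢
        omega
      · simp only [OccurFormula.size, OccurArgs.size, OccurPowArgs.size] at hs h4 ⊢
        have h5 := Nat.pow_le_pow_left hs 2
        omega
      · simp only [OccurArgs.length]; omega

/-- The unit-difference class of `occurClass D k s` lies in [ASSS16]'s reduced class with
parameters `(D+1, 2k, (s+2)², 2k)`. [cite: AgrawalEtAl2011, §4 (¶1)]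
locator: paper:arxiv-1111.0582 p0009.txt:L10–L13 -/
theorem unitDifferences_occurClass_subset_occurClassTopFanIn (D k s : ℕ) :
    {g : MvPolynomial ι F | ∃ C₀ ∈ occurClass F ι D k s, ∃ m₀ : ι,
        g = aeval (fun m : ι => if m = m₀ then X m + C 1 else (X m : MvPolynomial ι F)) C₀ - C₀} ⊆
      occurClassTopFanIn F ι (D + 1) (2 * k) ((s + 2) ^ 2) (2 * k) := by
  rintro g ⟨C₀, hC₀, m₀, rfl⟩
  exact sub_mem_occurClassTopFanIn_of_mem_occurClass hC₀ m₀

end UnitDifference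

/-! ### §3 The bridge for the N1 occur push: a generator for the REDUCED class (what [ASSS16] §4
proves, `FSV2018_thm48_topFanIn`) with an SV block upgrades to a generator for ALL of
`occurClass D k s` (one more SV block) -/

namespace ASSS16

open Literature.Barriers.ValiantsHypothesis

/-- **[ASSS16] §4 ¶1 in generator form (the tree's route to FSV Cor. 49 / the occur conjunct of
FSV Thm. 9, lead-np RULING (33)):** if `G ⊕ G^{SV'}_{n,K}` is a hitting-set generator for the
reduced class — depth `D+1`, occur `2k`, size `(s+2)²`, top `+` fan-in `≤ 2k` — then
`G ⊕ G^{SV'}_{n,K+1}` is one for every depth-`D` occur-`k` size-`s` formula, in characteristic `0`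
or `> (s+1)^D` (the degree bound `totalDegree_le_of_mem_occurClass`). Composition of
`isHittingSetGenerator_succ_of_unitDifferences` (the SV block supplies the shift `α + e_i`) with
the class inclusion `unitDifferences_occurClass_subset_occurClassTopFanIn`.
[cite: AgrawalEtAl2011, §4 (¶1); ForbesShpilkaVolk2018, Fact 27 and Cor. 49 (seq.) = ToC 5.3 / 5.25]
locator: paper:arxiv-1111.0582 p0009.txt:L3–L24 -/
theorem isHittingSetGenerator_occurClass_of_topFanIn {n : ℕ} {τ : Type*} (K D k s : ℕ)
    (G : multilinearMonomials n → MvPolynomial τ F)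
    (hchar : ringChar F = 0 ∨ (s + 1) ^ D < ringChar F)
    (hgen : IsHittingSetGenerator
      (occurClassTopFanIn F (multilinearMonomials n) (D + 1) (2 * k) ((s + 2) ^ 2) (2 * k))
      (fun m : multilinearMonomials n =>
        rename Sum.inl (G m) + rename Sum.inr (svGenCoeff F n K (m : Fin n →₀ ℕ)))) :
    IsHittingSetGenerator (occurClass F (multilinearMonomials n) D k s)
      (fun m : multilinearMonomials n =>
        rename Sum.inl (G m) + rename Sum.inr (svGenCoeff F n (K + 1) (m : Fin n →₀ ℕ))) :=
  isHittingSetGenerator_succ_of_unitDifferences K G _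
    (fun _ hC₀ => hchar.imp id fun h => (totalDegree_le_of_mem_occurClass hC₀).trans_lt h)
    (hgen.anti (unitDifferences_occurClass_subset_occurClassTopFanIn D k s))

end ASSS16

end Literature.Computability.AlgebraicComplexity

end
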